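import Mathlib
import Literature.NumberTheory.LFunctions.Zhang2022.TypedSection15AIdentities
import Literature.NumberTheory.LFunctions.Zhang2022.Section15Bcoef
import Literature.NumberTheory.LFunctions.Zhang2022.ToolkitDivisorMajorants
import Literature.NumberTheory.LFunctions.Zhang2022.SkeletonWindowPowers
import Literature.NumberTheory.LFunctions.Zhang2022.SmoothWeightDiagonalWide
import Literature.NumberTheory.LFunctions.Zhang2022.TypedSection17NuStarBound
import Literature.NumberTheory.LFunctions.Zhang2022.Section17Phi3minusLine
import HarnessLib

/-!
# Zhang (2022) §15, `Z22:§15.u012` kernel-checked: the orthogonality step closing (15.4)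

Topic `Literature/NumberTheory/LFunctions/Zhang2022` (Landau–Siegel audit tree; verdict-neutral; ZHANG-L discharge
lane, helper under the v19 leaf `Typed.Section15A.Eq15_6` through the tree edge
`Typed.Section15A.eq15_4_of : Step15_u008 → Step15_u009 → Step15_u012 → Eq15_4`). Y. Zhang, *Discrete mean estimates
and the Landau–Siegel zero*, arXiv:2211.02515v1 (2022) [Zhang2022LandauSiegel] — **an unrefereed manuscript under
adjudication**; this file PROVES one typed proof step of the manuscript, as printed (`TypedSection15A.Step15_u012`,
p. 81, tex L4052: "it follows that `Σ*_{ψ (mod p)} (1/2πi)∫_{(−1/2)} (Σ_m k̃(m)ψ̄(Dm)(Dm)^{s−1}) B(s,ψ)ω(s) ds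
≪ PD^{−4/5}`"), and says nothing about Theorems 1–2 of the source.

* `step15_u012_holds : ∀ c′, Step15_u012 c′` — UNCONDITIONAL (no (A), no named fact).

The proof, for `D` large and `p ∼ P`:
1. `ktildeSeries_eq_LSeries`, `Bpoly_eq_sum_Ico`, `Phi3Minus.omega_one_sub`: in the variable `w = 1 − s` the integrand on
   `σ = −1/2` is an absolutely convergent `L`-series `Σ_j a(j)j^{−w}` (`a(j) = [D∣j]k̃(j/D)ψ̄(j)`, `|k̃| ≤ τ₄`,
   `Zhang2022.Typed.Section15A.norm_ktilde_le`) times the FINITE polynomial `Σ_{n<PT⁻²} b(n)χψ(n)n^{w−1}` ((15.1)/(15.2):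
   `eq15_1_holds`, `Skeleton.bcoef_eq_zero_of_le`) times `ω_{−t₀}(w)`, on `Re w = 3/2`;
2. `integral_ktildeSeries_Bpoly_omega_eq`: "integrating term by term" = the tree's
   `SmoothWeight.integral_LSeries_mul_sum_mul_omega` (this subsumes `Z22:§15.u010`);
3. `sumPrim_integral_eq_tsum`: summing over the primitive `ψ (mod p)` and exchanging with the `j`-series
   (`SmoothWeight.summable_sum_term_mul`) isolates `X(j,n) = Σ*_ψ ψ(n)ψ̄(j)`, bounded by `1` for `j ≠ n` below `p`
   and by `p − 1` always (`Z22:§15.u011`, `PrimChar.norm_sum_ne_one_le(_one_of_ne)`);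
4. `SmoothWeight.norm_tsum_sum_term_mul_le_three` (file `SmoothWeightDiagonalWide`) splits into near / diagonal /
   far terms, bounded here by `term1_le` (`≪ P𝓛⁵⁴/D`), `term2_le` (`≪ Pτ₂(D)𝓛¹⁴⁴/D`, `τ₂(D) ≪ D^{1/10}`), `term3_le`
   (`≪ P^{5/2}𝓛¹⁸e^{−2𝓛⁸⁰¹}`, the Gaussian `ω` kills `j ≥ p`), each `≤ C·PD^{−4/5}` once `𝓛⁵⁴ ≤ D^{1/5}`,
   `𝓛¹⁴⁴ ≤ D^{1/10}`, `𝓛 ≥ 3`; divisor sums via `Zhang2022/ToolkitDivisorMajorants` and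
   `MeanSquareMajorant.sum_tau_sq_div_le`.

## References

* Y. Zhang, arXiv:2211.02515v1 (2022), §15 pp. 79–81 ((15.1), (15.2), proof of (15.4)); §2 (2.15).
  [cite: Zhang2022LandauSiegel, §15 p. 81 (proof of (15.4))]
-/

noncomputable section

open Complex Real ComplexConjugate MeasureTheory

namespace Literature.NumberTheory.LFunctions.Zhang2022.Typed.Section15A

open Literature.NumberTheory.LFunctions.Zhang2022.Skeleton

section KSeries

variable (c' : ℝ) {D : ℕ} [NeZero D] (χ : DirichletCharacter ℂ D) (x : Chr D)

omit [NeZero D] in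
/-- `k̃(0) = 0` (the antidiagonal of `0` is empty). [cite: Zhang2022LandauSiegel, §15 p. 80] -/
theorem ktilde_zero : ktilde c' D 0 = 0 := by
  simp [ktilde, MeanSquareMajorant.conv]

/-- **`Σ_m k̃(m)ψ̄(Dm)(Dm)^{s−1}` is an `L`-series in `w = 1 − s`** with coefficients
`j ↦ [D ∣ j] k̃(j/D)ψ̄(j)` supported on the multiples of `D`. [cite: Zhang2022LandauSiegel, §15 p. 80] -/
theorem ktildeSeries_eq_LSeries (s : ℂ) :
    ktildeSeries c' x s =
      LSeries (fun j : ℕ => if D ∣ j then ktilde c' D (j / D) * conj (x.ψ (j : ZMod x.p)) else 0)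
        (1 - s) := by
  have hD : D ≠ 0 := NeZero.ne D
  rw [ktildeSeries, LSeries]
  have hsupp : Function.support (fun j : ℕ => LSeries.term
      (fun j : ℕ => if D ∣ j then ktilde c' D (j / D) * conj (x.ψ (j : ZMod x.p)) else 0) (1 - s) j)
        ⊆ Set.range (fun m : ℕ => D * m) := by
    intro j hj
    rw [Function.mem_support] at hj
    by_cases hj0 : j = 0
    · exact absurd (by rw [hj0, LSeries.term_zero]) hj
    have hdvd : D ∣ j := by
      by_contra h
      exact hj (by rw [LSeries.term_of_ne_zero hj0, if_neg h, zero_div])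
    obtain ⟨m, rfl⟩ := hdvd
    exact ⟨m, rfl⟩
  rw [← (mul_right_injective₀ hD).tsum_eq hsupp]
  refine tsum_congr fun m => ?_
  rcases Nat.eq_zero_or_pos m with rfl | hm
  · simp [ktilde_zero]
  · have hDm : D * m ≠ 0 := Nat.mul_ne_zero hD hm.ne'
    rw [LSeries.term_of_ne_zero hDm, if_pos (Dvd.intro m rfl),
      Nat.mul_div_cancel_left m (Nat.pos_of_ne_zero hD)]

omit [NeZero D] in
/-- The coefficients `[D ∣ j] k̃(j/D)ψ̄(j)` are `≤ τ₄(j)` in modulus (`|k̃| ≤ τ₄`, `τ₄(j/D) ≤ τ₄(j)`, `|ψ̄| ≤ 1`;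
`𝓛 > 0`). [cite: Zhang2022LandauSiegel, §15 p. 80] -/
theorem norm_kCoeff_le (hℓ : 0 < ell D) (j : ℕ) :
    ‖(if D ∣ j then ktilde c' D (j / D) * conj (x.ψ (j : ZMod x.p)) else 0)‖ ≤
      MeanSquareMajorant.tau 4 j := by
  split_ifs with h
  · rcases Nat.eq_zero_or_pos j with rfl | hj
    · simp [ktilde_zero]
    · rw [norm_mul, RCLike.norm_conj]
      calc ‖ktilde c' D (j / D)‖ * ‖x.ψ (j : ZMod x.p)‖ ≤ MeanSquareMajorant.tau 4 (j / D) * 1 :=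
            mul_le_mul (norm_ktilde_le c' hℓ _) (DirichletCharacter.norm_le_one _ _) (norm_nonneg _)
              (MeanSquareMajorant.tau_nonneg _ _)
        _ ≤ MeanSquareMajorant.tau 4 j := by
            rw [mul_one]
            exact MeanSquareMajorant.tau_dvd_le (by norm_num) (Nat.div_dvd_of_dvd h) hj.ne'
  · rw [norm_zero]; exact MeanSquareMajorant.tau_nonneg _ _

omit [NeZero D] in
/-- The coefficient series converges absolutely on `Re w = 3/2` (indeed for `Re w > 1`).
[cite: Zhang2022LandauSiegel, §15 p. 80] -/
theorem lseriesSummable_kCoeff (hℓ : 0 < ell D) {σ : ℝ} (hσ : 1 < σ) :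
    LSeriesSummable (fun j : ℕ => if D ∣ j then ktilde c' D (j / D) * conj (x.ψ (j : ZMod x.p)) else 0)
      (σ : ℂ) := by
  refine Summable.of_norm_bounded (g := fun j : ℕ => MeanSquareMajorant.tau 4 j * (j : ℝ) ^ (-σ))
    (MeanSquareMajorant.summable_tau_mul_rpow_neg 4 hσ) fun j => ?_
  rw [LSeries.norm_term_eq]
  rcases eq_or_ne j 0 with rfl | hj
  · rw [if_pos rfl]
    exact mul_nonneg (MeanSquareMajorant.tau_nonneg _ _) (Real.rpow_nonneg (Nat.cast_nonneg _) _)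
  · rw [if_neg hj, Complex.ofReal_re, Real.rpow_neg (Nat.cast_nonneg _), div_eq_mul_inv]
    exact mul_le_mul_of_nonneg_right (norm_kCoeff_le c' x hℓ j) (inv_nonneg.mpr (by positivity))

/-- **(15.1) as a finite Dirichlet polynomial in `w = 1 − s`**: for `𝓛 ≥ 3`,
`B(s,ψ) = Σ_{1 ≤ n < ⌈PT⁻²⌉} b(n)χψ(n) n^{(1−s)−1}` (`b` vanishes from `PT⁻²` on, (15.2)).
[cite: Zhang2022LandauSiegel, §15 (15.1)–(15.2) p. 79] -/
theorem Bpoly_eq_sum_Ico (hD : 3 ≤ ell D) (s : ℂ) :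
    Bpoly χ x s = ∑ n ∈ Finset.Ico 1 ⌈bigP D / bigT D ^ 2⌉₊,
      bcoef D n * pc χ x n * (n : ℂ) ^ ((1 - s) - 1) := by
  rw [eq15_1_holds D χ x s]
  have hsub : (1 : ℂ) - s - 1 = -s := by ring
  simp_rw [hsub]
  refine tsum_eq_sum fun n hn => ?_
  rw [Finset.mem_Ico, not_and_or, not_le, not_lt] at hn
  rcases hn with h0 | hN
  · have h00 : n = 0 := by omega
    subst h00
    simp [bcoef]
  · rw [bcoef_eq_zero_of_le hD (le_trans (Nat.le_ceil _) (by exact_mod_cast hN))]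
    simp

omit [NeZero D] in
/-- `𝓛₂ = 𝓛⁴⁰⁰ > 0` once `𝓛 > 0`. [cite: Zhang2022LandauSiegel, §2 p. 5] -/
theorem ell2_pos (hℓ : 0 < ell D) : 0 < ell2 D := by
  rw [ell2]; positivity

/-- **The exact double-sum formula behind `Z22:§15.u012`** ("integrating term by term", the tree's
`SmoothWeight.integral_LSeries_mul_sum_mul_omega` on the line `σ = −1/2` read in `w = 1 − s`,
`Re w = 3/2`): for `𝓛 ≥ 3` and every `ψ ∈ Ψ`,
`(1/2π)∫_ℝ K(s)B(s,ψ)ω(s) dt = Σ_j Σ_n [a(j)j^{−s₀'}]·[b(n)χψ(n)n^{s₀'−1}]·exp{−𝓛₂² log²(n/j)}`,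
`s = −1/2 + it`, `s₀' = 1/2 − 2πit₀`, `a(j) = [D ∣ j]k̃(j/D)ψ̄(j)`.
[cite: Zhang2022LandauSiegel, §15 pp. 80–81 (proof of (15.4))] -/
theorem integral_ktildeSeries_Bpoly_omega_eq (hD : 3 ≤ ell D) :
    (1 / (2 * π) : ℂ) * ∫ t : ℝ, ktildeSeries c' x (-1 / 2 + t * I) * Bpoly χ x (-1 / 2 + t * I) *
        omegaW D (-1 / 2 + t * I)
      = ∑' j : ℕ, ∑ n ∈ Finset.Ico 1 ⌈bigP D / bigT D ^ 2⌉₊,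
          LSeries.term (fun j : ℕ => if D ∣ j then ktilde c' D (j / D) * conj (x.ψ (j : ZMod x.p)) else 0)
              (SmoothWeight.s0 (-t0 D)) j *
            (bcoef D n * pc χ x n * (n : ℂ) ^ (SmoothWeight.s0 (-t0 D) - 1)) *
            cexp (-(ell2 D : ℂ) ^ 2 * (Real.log ((n : ℝ) / j) : ℂ) ^ 2) := by
  have hℓ : 0 < ell D := by linarith
  have hL := ell2_pos hℓ
  set a : ℕ → ℂ := fun j => if D ∣ j then ktilde c' D (j / D) * conj (x.ψ (j : ZMod x.p)) else 0
    with ha_def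
  set S : Finset ℕ := Finset.Ico 1 ⌈bigP D / bigT D ^ 2⌉₊ with hS_def
  have hS : 0 ∉ S := by simp [hS_def]
  have ha : LSeriesSummable a ((1 + 1 / 2 : ℝ) : ℂ) := lseriesSummable_kCoeff c' x hℓ (by norm_num)
  have key := SmoothWeight.integral_LSeries_mul_sum_mul_omega hL (-t0 D) 1 ha
    (fun n => bcoef D n * pc χ x n) hS
  -- the integrand in the `t`-parametrisation
  set F : ℝ → ℂ := fun t => ktildeSeries c' x (-1 / 2 + t * I) * Bpoly χ x (-1 / 2 + t * I) *
    omegaW D (-1 / 2 + t * I) with hF_def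
  have hpt : ∀ v : ℝ, (1 : ℂ) - (((1 : ℝ) : ℂ) + SmoothWeight.s0 (-t0 D) + v * I)
      = -1 / 2 + (((2 * π * t0 D - v : ℝ)) : ℂ) * I := by
    intro v; rw [SmoothWeight.s0_def]; push_cast; ring
  have hGF : ∀ v : ℝ,
      LSeries a (((1 : ℝ) : ℂ) + SmoothWeight.s0 (-t0 D) + v * I) *
          (∑ n ∈ S, bcoef D n * pc χ x n *
            (n : ℂ) ^ ((((1 : ℝ) : ℂ) + SmoothWeight.s0 (-t0 D) + v * I) - 1)) *
          SmoothWeight.omega (ell2 D) (-t0 D) (((1 : ℝ) : ℂ) + SmoothWeight.s0 (-t0 D) + v * I)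
        = F (2 * π * t0 D - v) := by
    intro v
    set w : ℂ := ((1 : ℝ) : ℂ) + SmoothWeight.s0 (-t0 D) + v * I with hw
    have hs : (-1 / 2 : ℂ) + ((2 * π * t0 D - v : ℝ) : ℂ) * I = 1 - w := (hpt v).symm
    have hexp : (1 : ℂ) - (1 - w) - 1 = w - 1 := by ring
    simp only [hF_def]
    rw [hs, ktildeSeries_eq_LSeries, Bpoly_eq_sum_Ico χ x hD, hexp, sub_sub_cancel, omegaW,
      Phi3Minus.omega_one_sub, ← ha_def]
  calc (1 / (2 * π) : ℂ) * ∫ t : ℝ, F t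
      = (1 / (2 * π) : ℂ) * ∫ v : ℝ, F (2 * π * t0 D - v) := by
        rw [integral_sub_left_eq_self F volume (2 * π * t0 D)]
    _ = (1 / (2 * π) : ℂ) * ∫ v : ℝ,
          LSeries a (((1 : ℝ) : ℂ) + SmoothWeight.s0 (-t0 D) + v * I) *
          (∑ n ∈ S, bcoef D n * pc χ x n *
            (n : ℂ) ^ ((((1 : ℝ) : ℂ) + SmoothWeight.s0 (-t0 D) + v * I) - 1)) *
          SmoothWeight.omega (ell2 D) (-t0 D) (((1 : ℝ) : ℂ) + SmoothWeight.s0 (-t0 D) + v * I) := by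
        simp_rw [hGF]
    _ = _ := key

end KSeries

section PsiSum

variable (c' : ℝ) {D : ℕ} [NeZero D] (χ : DirichletCharacter ℂ D)

omit [NeZero D] in
/-- Congruence for `Σ*_{ψ (mod p)}`: the summand may be replaced by a primitivity-independent one it
equals on primitive `ψ`. [cite: Zhang2022LandauSiegel, §15 p. 80] -/
theorem sumPrim_congr {p : ℕ} {F : (ψ : DirichletCharacter ℂ p) → ψ.IsPrimitive → ℂ}
    {G : DirichletCharacter ℂ p → ℂ} (h : ∀ (ψ : DirichletCharacter ℂ p) (hψ : ψ.IsPrimitive), F ψ hψ = G ψ) :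
    sumPrim F = sumPrim (fun ψ _ => G ψ) := by
  unfold sumPrim
  refine finsum_congr fun ψ => ?_
  split_ifs with hψ
  · exact h ψ hψ
  · rfl

omit [NeZero D] in
/-- The `ψ̄(j)` factor of the coefficients pulls out of the `L`-series term:
`term([D∣j]k̃(j/D)ψ̄(j)) = term([D∣j]k̃(j/D))·ψ̄(j)`. [cite: Zhang2022LandauSiegel, §15 p. 80] -/
theorem term_kCoeff_eq (x : Chr D) (s : ℂ) (j : ℕ) :
    LSeries.term (fun j : ℕ => if D ∣ j then ktilde c' D (j / D) * conj (x.ψ (j : ZMod x.p)) else 0) s j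
      = LSeries.term (fun j : ℕ => if D ∣ j then ktilde c' D (j / D) else 0) s j *
          conj (x.ψ (j : ZMod x.p)) := by
  rcases eq_or_ne j 0 with rfl | hj
  · simp [LSeries.term_zero]
  · rw [LSeries.term_of_ne_zero hj, LSeries.term_of_ne_zero hj]
    split_ifs <;> ring

omit [NeZero D] in
/-- `|[D ∣ j]k̃(j/D)| ≤ τ₄(j/D) ≤ τ₄(j)` (`𝓛 > 0`). [cite: Zhang2022LandauSiegel, §15 p. 80] -/
theorem norm_aCoeff_le (hℓ : 0 < ell D) (j : ℕ) :
    ‖(if D ∣ j then ktilde c' D (j / D) else 0)‖ ≤ MeanSquareMajorant.tau 4 j := by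
  split_ifs with h
  · rcases Nat.eq_zero_or_pos j with rfl | hj
    · simp [ktilde_zero]
    · exact (norm_ktilde_le c' hℓ _).trans
        (MeanSquareMajorant.tau_dvd_le (by norm_num) (Nat.div_dvd_of_dvd h) hj.ne')
  · rw [norm_zero]; exact MeanSquareMajorant.tau_nonneg _ _

omit [NeZero D] in
/-- `Σ_j [D∣j]k̃(j/D) j^{−w}` converges absolutely at `w = 3/2`. [cite: Zhang2022LandauSiegel, §15 p. 80] -/
theorem lseriesSummable_aCoeff (hℓ : 0 < ell D) :
    LSeriesSummable (fun j : ℕ => if D ∣ j then ktilde c' D (j / D) else 0) (3 / 2 : ℂ) := by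
  refine Summable.of_norm_bounded (g := fun j : ℕ => MeanSquareMajorant.tau 4 j * (j : ℝ) ^ (-(3 / 2 : ℝ)))
    (MeanSquareMajorant.summable_tau_mul_rpow_neg 4 (by norm_num)) fun j => ?_
  rw [LSeries.norm_term_eq]
  rcases eq_or_ne j 0 with rfl | hj
  · rw [if_pos rfl]
    exact mul_nonneg (MeanSquareMajorant.tau_nonneg _ _) (Real.rpow_nonneg (Nat.cast_nonneg _) _)
  · have hre : (3 / 2 : ℂ).re = 3 / 2 := by norm_num
    rw [if_neg hj, hre, Real.rpow_neg (Nat.cast_nonneg _), div_eq_mul_inv]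
    exact mul_le_mul_of_nonneg_right (norm_aCoeff_le c' hℓ j) (inv_nonneg.mpr (by positivity))

/-- **`Σ*_{ψ (mod p)}` of the term-by-term formula, with the character sum isolated** (the display of
`Z22:§15.u012` before "it follows that", p. 81): for `𝓛 ≥ 3` and `p ∼ P`,
`Σ*_ψ (1/2π)∫ K(s)B(s,ψ)ω(s)dt = Σ_j Σ_n [a⁰(j)j^{−s₀'}][b(n)χ(n)n^{s₀'−1}]e^{−𝓛₂²log²(n/j)} · Σ*_ψ ψ(n)ψ̄(j)`,
`a⁰(j) = [D∣j]k̃(j/D)` (the `ψ`-sum and the `j`-series exchanged by absolute convergence,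
`SmoothWeight.summable_sum_term_mul`). [cite: Zhang2022LandauSiegel, §15 pp. 80–81 (proof of (15.4))] -/
theorem sumPrim_integral_eq_tsum (hD : 3 ≤ ell D) {p : ℕ} [Fact p.Prime] (hp : p ∈ primeWindow D) :
    sumPrim (fun (ψ : DirichletCharacter ℂ p) hψ =>
        (1 / (2 * π) : ℂ) * ∫ t : ℝ,
          ktildeSeries c' (⟨p, hp, ψ, hψ⟩ : Chr D) (-1 / 2 + t * I) *
            Bpoly χ ⟨p, hp, ψ, hψ⟩ (-1 / 2 + t * I) * omegaW D (-1 / 2 + t * I))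
      = ∑' j : ℕ, ∑ n ∈ Finset.Ico 1 ⌈bigP D / bigT D ^ 2⌉₊,
          LSeries.term (fun j : ℕ => if D ∣ j then ktilde c' D (j / D) else 0)
              (SmoothWeight.s0 (-t0 D)) j *
            (bcoef D n * χ (n : ZMod D) * (n : ℂ) ^ (SmoothWeight.s0 (-t0 D) - 1)) *
            cexp (-(ell2 D : ℂ) ^ 2 * (Real.log ((n : ℝ) / j) : ℂ) ^ 2) *
          ∑ ψ ∈ (Finset.univ : Finset (DirichletCharacter ℂ p)).erase 1,
            ψ (n : ZMod p) * ψ⁻¹ (j : ZMod p) := by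
  have hℓ : 0 < ell D := by linarith
  have hL := ell2_pos hℓ
  set S : Finset ℕ := Finset.Ico 1 ⌈bigP D / bigT D ^ 2⌉₊ with hS_def
  have hS : 0 ∉ S := by simp [hS_def]
  set s₁ : ℂ := SmoothWeight.s0 (-t0 D) with hs₁
  set a0 : ℕ → ℂ := fun j => if D ∣ j then ktilde c' D (j / D) else 0 with ha0
  set T : ℕ → ℕ → ℂ := fun j n => LSeries.term a0 s₁ j *
      (bcoef D n * χ (n : ZMod D) * (n : ℂ) ^ (s₁ - 1)) *
      cexp (-(ell2 D : ℂ) ^ 2 * (Real.log ((n : ℝ) / j) : ℂ) ^ 2) with hT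
  -- Step 1: every integral, term by term, with `ψ(n)ψ̄(j)` pulled out
  have h1 : ∀ (ψ : DirichletCharacter ℂ p) (hψ : ψ.IsPrimitive),
      (1 / (2 * π) : ℂ) * ∫ t : ℝ,
          ktildeSeries c' (⟨p, hp, ψ, hψ⟩ : Chr D) (-1 / 2 + t * I) *
            Bpoly χ ⟨p, hp, ψ, hψ⟩ (-1 / 2 + t * I) * omegaW D (-1 / 2 + t * I)
        = ∑' j : ℕ, ∑ n ∈ S, T j n * (ψ (n : ZMod p) * ψ⁻¹ (j : ZMod p)) := by
    intro ψ hψ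
    rw [integral_ktildeSeries_Bpoly_omega_eq c' χ ⟨p, hp, ψ, hψ⟩ hD]
    refine tsum_congr fun j => Finset.sum_congr rfl fun n _ => ?_
    rw [term_kCoeff_eq, ← PrimChar.inv_apply_eq_conj]
    simp only [hT, pc]
    ring
  rw [sumPrim_congr h1, sumPrim_eq_sum_erase_one]
  -- Step 2: exchange `Σ_ψ` and `Σ_j`
  have hsum : ∀ ψ ∈ (Finset.univ : Finset (DirichletCharacter ℂ p)).erase 1,
      Summable (fun j : ℕ => ∑ n ∈ S, T j n * (ψ (n : ZMod p) * ψ⁻¹ (j : ZMod p))) := by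
    intro ψ _
    have h := SmoothWeight.summable_sum_term_mul hL (-t0 D) (lseriesSummable_aCoeff c' hℓ)
      (fun n => bcoef D n * χ (n : ZMod D)) hS (fun j n => ψ (n : ZMod p) * ψ⁻¹ (j : ZMod p))
      (Xb := 1) (fun j n _ => by
        rw [norm_mul]
        exact mul_le_one₀ (DirichletCharacter.norm_le_one ψ _) (norm_nonneg _)
          (DirichletCharacter.norm_le_one ψ⁻¹ _))
    simpa only [hT] using h
  rw [← Summable.tsum_finsetSum hsum]
  refine tsum_congr fun j => ?_
  rw [Finset.sum_comm]
  refine Finset.sum_congr rfl fun n _ => ?_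
  rw [Finset.mul_sum]

end PsiSum

section Bounds

variable (c' : ℝ) {D : ℕ} [NeZero D] (χ : DirichletCharacter ℂ D)

omit [NeZero D] in
/-- `‖term a⁰ (3/2) j‖ ≤ τ₄(j) j^{−3/2}`. [cite: Zhang2022LandauSiegel, §15 p. 80] -/
theorem norm_term_aCoeff_le (hℓ : 0 < ell D) (j : ℕ) :
    ‖LSeries.term (fun j : ℕ => if D ∣ j then ktilde c' D (j / D) else 0) (3 / 2 : ℂ) j‖
      ≤ MeanSquareMajorant.tau 4 j * (j : ℝ) ^ (-(3 / 2 : ℝ)) := by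
  rw [LSeries.norm_term_eq]
  rcases eq_or_ne j 0 with rfl | hj
  · rw [if_pos rfl]
    exact mul_nonneg (MeanSquareMajorant.tau_nonneg _ _) (Real.rpow_nonneg (Nat.cast_nonneg _) _)
  · have hre : (3 / 2 : ℂ).re = 3 / 2 := by norm_num
    rw [if_neg hj, hre, Real.rpow_neg (Nat.cast_nonneg _), div_eq_mul_inv]
    exact mul_le_mul_of_nonneg_right (norm_aCoeff_le c' hℓ j) (inv_nonneg.mpr (by positivity))

omit [NeZero D] in
/-- `Σ_j ‖term a⁰ (3/2) j‖ ≤ Σ_j τ₄(j)j^{−3/2}`. [cite: Zhang2022LandauSiegel, §15 p. 80] -/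
theorem tsum_norm_term_aCoeff_le (hℓ : 0 < ell D) :
    ∑' j : ℕ, ‖LSeries.term (fun j : ℕ => if D ∣ j then ktilde c' D (j / D) else 0) (3 / 2 : ℂ) j‖
      ≤ ∑' j : ℕ, MeanSquareMajorant.tau 4 j * (j : ℝ) ^ (-(3 / 2 : ℝ)) :=
  Summable.tsum_le_tsum (norm_term_aCoeff_le c' hℓ) (summable_norm_iff.mpr (lseriesSummable_aCoeff c' hℓ))
    (MeanSquareMajorant.summable_tau_mul_rpow_neg 4 (by norm_num))

omit [NeZero D] in
/-- `n^{−1/2} ≤ N^{1/2}/n` and `n^{1/2} ≤ N^{3/2}/n` for `1 ≤ n ≤ N`. [folklore] -/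
private theorem rpow_le_div {n N : ℕ} (hn : 1 ≤ n) (hnN : n ≤ N) :
    (n : ℝ) ^ (-(1 / 2 : ℝ)) ≤ (N : ℝ) ^ (1 / 2 : ℝ) / n ∧
      (n : ℝ) ^ (1 / 2 : ℝ) ≤ (N : ℝ) ^ (3 / 2 : ℝ) / n := by
  have hn' : (0 : ℝ) < n := by exact_mod_cast hn
  have hnN' : (n : ℝ) ≤ N := by exact_mod_cast hnN
  constructor
  · rw [le_div_iff₀ hn', show (-(1 / 2 : ℝ)) = (1 / 2 : ℝ) - 1 by norm_num,
      Real.rpow_sub_one hn'.ne', div_mul_cancel₀ _ hn'.ne']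
    exact Real.rpow_le_rpow hn'.le hnN' (by norm_num)
  · rw [le_div_iff₀ hn', show (1 / 2 : ℝ) = (3 / 2 : ℝ) - 1 by norm_num,
      Real.rpow_sub_one hn'.ne', div_mul_cancel₀ _ hn'.ne']
    exact Real.rpow_le_rpow hn'.le hnN' (by norm_num)

omit [NeZero D] in
/-- **Near `b`-factor**: `Σ_{1≤n<N_b} |b(n)χ(n)| n^{−1/2} ≤ C_b N_b^{1/2}(1 + log N_b)²`.
[cite: Zhang2022LandauSiegel, §15 p. 81] -/
theorem sum_norm_bCoeff_rpow_neg_le (hD2 : 2 ≤ Real.log D) (Nb : ℕ) :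
    ∑ n ∈ Finset.Ico 1 Nb, ‖bcoef D n * χ (n : ZMod D)‖ * (n : ℝ) ^ (-(1 / 2 : ℝ))
      ≤ (1 + ‖iota2‖) * (‖iota3‖ + ‖iota4‖) * ((Nb : ℝ) ^ (1 / 2 : ℝ) * (1 + Real.log Nb) ^ 2) := by
  set Cb : ℝ := (1 + ‖iota2‖) * (‖iota3‖ + ‖iota4‖) with hCb
  have hCb0 : 0 ≤ Cb := by positivity
  calc ∑ n ∈ Finset.Ico 1 Nb, ‖bcoef D n * χ (n : ZMod D)‖ * (n : ℝ) ^ (-(1 / 2 : ℝ))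
      ≤ ∑ n ∈ Finset.Icc 1 Nb, ‖bcoef D n * χ (n : ZMod D)‖ * (n : ℝ) ^ (-(1 / 2 : ℝ)) :=
        Finset.sum_le_sum_of_subset_of_nonneg Finset.Ico_subset_Icc_self (fun n _ _ => by positivity)
    _ ≤ ∑ n ∈ Finset.Icc 1 Nb, Cb * (Nb : ℝ) ^ (1 / 2 : ℝ) * (MeanSquareMajorant.tau 2 n / n) := by
        refine Finset.sum_le_sum fun n hn => ?_
        obtain ⟨h1, h2⟩ := Finset.mem_Icc.mp hn
        have hr := (rpow_le_div h1 h2).1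
        calc ‖bcoef D n * χ (n : ZMod D)‖ * (n : ℝ) ^ (-(1 / 2 : ℝ))
            ≤ (Cb * MeanSquareMajorant.tau 2 n) * ((Nb : ℝ) ^ (1 / 2 : ℝ) / n) :=
              mul_le_mul (Typed.Section17.norm_bcoef_mul_chi_le χ hD2 n) hr (by positivity)
                (by have := MeanSquareMajorant.tau_nonneg 2 n; positivity)
          _ = _ := by ring
    _ = Cb * (Nb : ℝ) ^ (1 / 2 : ℝ) * ∑ n ∈ Finset.Icc 1 Nb, MeanSquareMajorant.tau 2 n / n := by
        rw [Finset.mul_sum]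
    _ ≤ Cb * (Nb : ℝ) ^ (1 / 2 : ℝ) * (1 + Real.log Nb) ^ 2 :=
        mul_le_mul_of_nonneg_left (MeanSquareMajorant.sum_tau_div_Icc_le_log_pow 2 Nb) (by positivity)
    _ = _ := by ring

omit [NeZero D] in
/-- **Far `b`-factor**: `Σ_{1≤n<N_b} |b(n)χ(n)| n^{1/2} ≤ C_b N_b^{3/2}(1 + log N_b)²`.
[cite: Zhang2022LandauSiegel, §15 p. 81] -/
theorem sum_norm_bCoeff_rpow_le (hD2 : 2 ≤ Real.log D) (Nb : ℕ) :
    ∑ n ∈ Finset.Ico 1 Nb, ‖bcoef D n * χ (n : ZMod D)‖ * (n : ℝ) ^ (1 / 2 : ℝ)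
      ≤ (1 + ‖iota2‖) * (‖iota3‖ + ‖iota4‖) * ((Nb : ℝ) ^ (3 / 2 : ℝ) * (1 + Real.log Nb) ^ 2) := by
  set Cb : ℝ := (1 + ‖iota2‖) * (‖iota3‖ + ‖iota4‖) with hCb
  have hCb0 : 0 ≤ Cb := by positivity
  calc ∑ n ∈ Finset.Ico 1 Nb, ‖bcoef D n * χ (n : ZMod D)‖ * (n : ℝ) ^ (1 / 2 : ℝ)
      ≤ ∑ n ∈ Finset.Icc 1 Nb, ‖bcoef D n * χ (n : ZMod D)‖ * (n : ℝ) ^ (1 / 2 : ℝ) :=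
        Finset.sum_le_sum_of_subset_of_nonneg Finset.Ico_subset_Icc_self (fun n _ _ => by positivity)
    _ ≤ ∑ n ∈ Finset.Icc 1 Nb, Cb * (Nb : ℝ) ^ (3 / 2 : ℝ) * (MeanSquareMajorant.tau 2 n / n) := by
        refine Finset.sum_le_sum fun n hn => ?_
        obtain ⟨h1, h2⟩ := Finset.mem_Icc.mp hn
        have hr := (rpow_le_div h1 h2).2
        calc ‖bcoef D n * χ (n : ZMod D)‖ * (n : ℝ) ^ (1 / 2 : ℝ)
            ≤ (Cb * MeanSquareMajorant.tau 2 n) * ((Nb : ℝ) ^ (3 / 2 : ℝ) / n) :=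
              mul_le_mul (Typed.Section17.norm_bcoef_mul_chi_le χ hD2 n) hr (by positivity)
                (by have := MeanSquareMajorant.tau_nonneg 2 n; positivity)
          _ = _ := by ring
    _ = Cb * (Nb : ℝ) ^ (3 / 2 : ℝ) * ∑ n ∈ Finset.Icc 1 Nb, MeanSquareMajorant.tau 2 n / n := by
        rw [Finset.mul_sum]
    _ ≤ Cb * (Nb : ℝ) ^ (3 / 2 : ℝ) * (1 + Real.log Nb) ^ 2 :=
        mul_le_mul_of_nonneg_left (MeanSquareMajorant.sum_tau_div_Icc_le_log_pow 2 Nb) (by positivity)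
    _ = _ := by ring

/-- **Near `a`-factor** (the multiples of `D` below `p`, `j = Dm`, `m < ⌈p/D⌉ =: M`):
`Σ_{j<p} |a⁰(j)| j^{−1/2} ≤ D^{−1/2}·M^{1/2}(1 + log M)⁴`. [cite: Zhang2022LandauSiegel, §15 p. 81] -/
theorem sum_range_norm_aCoeff_rpow_le (hℓ : 0 < ell D) (p : ℕ) :
    ∑ j ∈ Finset.range p, ‖(if D ∣ j then ktilde c' D (j / D) else 0)‖ * (j : ℝ) ^ (-(1 / 2 : ℝ))
      ≤ (D : ℝ) ^ (-(1 / 2 : ℝ)) * ((⌈(p : ℝ) / D⌉₊ : ℝ) ^ (1 / 2 : ℝ) *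
          (1 + Real.log (⌈(p : ℝ) / D⌉₊ : ℕ)) ^ 4) := by
  classical
  have hD : D ≠ 0 := NeZero.ne D
  have hD' : (0 : ℝ) < D := by exact_mod_cast Nat.pos_of_ne_zero hD
  set M : ℕ := ⌈(p : ℝ) / D⌉₊ with hM
  set f : ℕ → ℝ := fun j => ‖(if D ∣ j then ktilde c' D (j / D) else 0)‖ * (j : ℝ) ^ (-(1 / 2 : ℝ))
    with hf
  have hf0 : ∀ j, 0 ≤ f j := fun j => by positivity
  -- only the multiples `j = Dm`, `1 ≤ m ≤ M`, contribute
  have hzero : ∀ j ∈ Finset.range p, f j ≠ 0 → D ∣ j ∧ j ≠ 0 := by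
    intro j _ hne
    constructor
    · by_contra h
      exact hne (by simp [hf, h])
    · rintro rfl
      exact hne (by simp [hf, ktilde_zero])
  have hsub : (Finset.range p).filter (fun j => D ∣ j ∧ j ≠ 0) ⊆
      (Finset.Icc 1 M).image (fun m => D * m) := by
    intro j hj
    obtain ⟨hjp, ⟨m, rfl⟩, hj0⟩ := Finset.mem_filter.mp hj
    refine Finset.mem_image.mpr ⟨m, Finset.mem_Icc.mpr ⟨?_, ?_⟩, rfl⟩
    · exact Nat.one_le_iff_ne_zero.mpr fun h => hj0 (by rw [h, mul_zero])
    · have hlt : (m : ℝ) < (p : ℝ) / D := by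
        rw [lt_div_iff₀ hD']
        have := Finset.mem_range.mp hjp
        calc (m : ℝ) * D = ((D * m : ℕ) : ℝ) := by push_cast; ring
          _ < p := by exact_mod_cast this
      exact (Nat.lt_ceil.mpr hlt).le
  calc ∑ j ∈ Finset.range p, f j
      = ∑ j ∈ (Finset.range p).filter (fun j => D ∣ j ∧ j ≠ 0), f j :=
        (Finset.sum_filter_of_ne hzero).symm
    _ ≤ ∑ j ∈ (Finset.Icc 1 M).image (fun m => D * m), f j :=
        Finset.sum_le_sum_of_subset_of_nonneg hsub fun j _ _ => hf0 j
    _ = ∑ m ∈ Finset.Icc 1 M, f (D * m) :=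
        Finset.sum_image fun m _ m' _ h => mul_right_injective₀ hD h
    _ ≤ ∑ m ∈ Finset.Icc 1 M, (D : ℝ) ^ (-(1 / 2 : ℝ)) * (M : ℝ) ^ (1 / 2 : ℝ) *
          (MeanSquareMajorant.tau 4 m / m) := by
        refine Finset.sum_le_sum fun m hm => ?_
        obtain ⟨h1, h2⟩ := Finset.mem_Icc.mp hm
        have hm' : (0 : ℝ) < m := by exact_mod_cast h1
        simp only [hf]
        rw [if_pos (Dvd.intro m rfl), Nat.mul_div_cancel_left m (Nat.pos_of_ne_zero hD)]
        have hr := (rpow_le_div h1 h2).1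
        have hDm : ((D * m : ℕ) : ℝ) ^ (-(1 / 2 : ℝ)) = (D : ℝ) ^ (-(1 / 2 : ℝ)) * (m : ℝ) ^ (-(1 / 2 : ℝ)) := by
          push_cast
          exact Real.mul_rpow hD'.le hm'.le
        rw [hDm]
        calc ‖ktilde c' D m‖ * ((D : ℝ) ^ (-(1 / 2 : ℝ)) * (m : ℝ) ^ (-(1 / 2 : ℝ)))
            ≤ MeanSquareMajorant.tau 4 m * ((D : ℝ) ^ (-(1 / 2 : ℝ)) * ((M : ℝ) ^ (1 / 2 : ℝ) / m)) :=
              mul_le_mul (norm_ktilde_le c' hℓ m) (mul_le_mul_of_nonneg_left hr (by positivity))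
                (by positivity) (MeanSquareMajorant.tau_nonneg _ _)
          _ = _ := by ring
    _ = (D : ℝ) ^ (-(1 / 2 : ℝ)) * (M : ℝ) ^ (1 / 2 : ℝ) *
          ∑ m ∈ Finset.Icc 1 M, MeanSquareMajorant.tau 4 m / m := by rw [Finset.mul_sum]
    _ ≤ (D : ℝ) ^ (-(1 / 2 : ℝ)) * (M : ℝ) ^ (1 / 2 : ℝ) * (1 + Real.log M) ^ 4 :=
        mul_le_mul_of_nonneg_left (MeanSquareMajorant.sum_tau_div_Icc_le_log_pow 4 M) (by positivity)
    _ = _ := by ring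

/-- **Diagonal factor** (`n = j = Dm`): `Σ_{1≤n<N_b} |a⁰(n)||b(n)χ(n)|/n ≤ C_b·τ₂(D)D⁻¹·K·(log N_b)¹⁶`,
`K = majorantConst 16 8` (`τ₂(Dm) ≤ τ₂(D)τ₂(m)`, `τ₄τ₂ ≤ τ₄²`, `Σ_{m≤N} τ₄(m)²/m ≪ log¹⁶N`).
[cite: Zhang2022LandauSiegel, §15 p. 81] -/
theorem sum_norm_aCoeff_bCoeff_div_le (hℓ : 0 < ell D) (hD2 : 2 ≤ Real.log D) {Nb : ℕ} (hNb : 2 ≤ Nb) :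
    ∑ n ∈ Finset.Ico 1 Nb, ‖(if D ∣ n then ktilde c' D (n / D) else 0)‖ *
        ‖bcoef D n * χ (n : ZMod D)‖ / n
      ≤ (1 + ‖iota2‖) * (‖iota3‖ + ‖iota4‖) * (MeanSquareMajorant.tau 2 D * (D : ℝ)⁻¹ *
          (MeanSquareMajorant.majorantConst 16 8 * Real.log Nb ^ 16)) := by
  classical
  have hD : D ≠ 0 := NeZero.ne D
  have hD' : (0 : ℝ) < D := by exact_mod_cast Nat.pos_of_ne_zero hD
  set Cb : ℝ := (1 + ‖iota2‖) * (‖iota3‖ + ‖iota4‖) with hCb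
  have hCb0 : 0 ≤ Cb := by positivity
  set f : ℕ → ℝ := fun n => ‖(if D ∣ n then ktilde c' D (n / D) else 0)‖ *
    ‖bcoef D n * χ (n : ZMod D)‖ / n with hf
  have hf0 : ∀ n, 0 ≤ f n := fun n => by positivity
  have hzero : ∀ n ∈ Finset.Ico 1 Nb, f n ≠ 0 → D ∣ n := by
    intro n _ hne
    by_contra h
    exact hne (by simp [hf, h])
  have hsub : (Finset.Ico 1 Nb).filter (fun n => D ∣ n) ⊆ (Finset.Icc 1 Nb).image (fun m => D * m) := by
    intro n hn
    obtain ⟨hnI, ⟨m, rfl⟩⟩ := Finset.mem_filter.mp hn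
    obtain ⟨h1, h2⟩ := Finset.mem_Ico.mp hnI
    refine Finset.mem_image.mpr ⟨m, Finset.mem_Icc.mpr ⟨?_, ?_⟩, rfl⟩
    · exact Nat.one_le_iff_ne_zero.mpr fun h => by simp [h] at h1
    · exact le_trans (Nat.le_mul_of_pos_left m (Nat.pos_of_ne_zero hD)) h2.le
  have htau := MeanSquareMajorant.sum_tau_sq_div_le 4 hNb
  have hK0 : 0 ≤ MeanSquareMajorant.majorantConst 16 8 := (MeanSquareMajorant.majorantConst_pos 16 8).le
  calc ∑ n ∈ Finset.Ico 1 Nb, f n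
      = ∑ n ∈ (Finset.Ico 1 Nb).filter (fun n => D ∣ n), f n := (Finset.sum_filter_of_ne hzero).symm
    _ ≤ ∑ n ∈ (Finset.Icc 1 Nb).image (fun m => D * m), f n :=
        Finset.sum_le_sum_of_subset_of_nonneg hsub fun n _ _ => hf0 n
    _ = ∑ m ∈ Finset.Icc 1 Nb, f (D * m) :=
        Finset.sum_image fun m _ m' _ h => mul_right_injective₀ hD h
    _ ≤ ∑ m ∈ Finset.Icc 1 Nb, Cb * MeanSquareMajorant.tau 2 D * (D : ℝ)⁻¹ *
          (MeanSquareMajorant.tau 4 m ^ 2 / m) := by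
        refine Finset.sum_le_sum fun m hm => ?_
        obtain ⟨h1, _⟩ := Finset.mem_Icc.mp hm
        have hm' : (0 : ℝ) < m := by exact_mod_cast h1
        simp only [hf]
        rw [if_pos (Dvd.intro m rfl), Nat.mul_div_cancel_left m (Nat.pos_of_ne_zero hD)]
        have hb := Typed.Section17.norm_bcoef_mul_chi_le χ hD2 (D * m)
        have ht2 : MeanSquareMajorant.tau 2 (D * m) ≤ MeanSquareMajorant.tau 2 D * MeanSquareMajorant.tau 2 m :=
          MeanSquareMajorant.tau_mul_le 2 D m
        have ht24 : MeanSquareMajorant.tau 2 m ≤ MeanSquareMajorant.tau 4 m :=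
          MeanSquareMajorant.tau_le_tau_of_le (by norm_num) m
        have h4 := MeanSquareMajorant.tau_nonneg 4 m
        have h2D := MeanSquareMajorant.tau_nonneg 2 D
        have hk := norm_ktilde_le c' hℓ m
        have hDm : ((D * m : ℕ) : ℝ) = (D : ℝ) * m := by push_cast; ring
        rw [hDm, div_le_iff₀ (by positivity)]
        calc ‖ktilde c' D m‖ * ‖bcoef D (D * m) * χ ((D * m : ℕ) : ZMod D)‖
            ≤ MeanSquareMajorant.tau 4 m * (Cb * MeanSquareMajorant.tau 2 (D * m)) :=
              mul_le_mul hk hb (norm_nonneg _) h4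
          _ ≤ MeanSquareMajorant.tau 4 m * (Cb * (MeanSquareMajorant.tau 2 D * MeanSquareMajorant.tau 4 m)) := by
              gcongr
              exact ht2.trans (mul_le_mul_of_nonneg_left ht24 h2D)
          _ = Cb * MeanSquareMajorant.tau 2 D * (D : ℝ)⁻¹ * (MeanSquareMajorant.tau 4 m ^ 2 / m) *
                ((D : ℝ) * m) := by
              field_simp
    _ = Cb * MeanSquareMajorant.tau 2 D * (D : ℝ)⁻¹ *
          ∑ m ∈ Finset.Icc 1 Nb, MeanSquareMajorant.tau 4 m ^ 2 / m := by rw [Finset.mul_sum]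
    _ ≤ Cb * MeanSquareMajorant.tau 2 D * (D : ℝ)⁻¹ *
          (MeanSquareMajorant.majorantConst 16 8 * Real.log Nb ^ 16) := by
        refine mul_le_mul_of_nonneg_left ?_ (by have := MeanSquareMajorant.tau_nonneg 2 D; positivity)
        simpa using htau
    _ = _ := by ring

end Bounds

section Sizes

variable {D : ℕ}

/-- `ℓ ≥ 3 ⇒ T ≥ 1` and `T² ≥ e^{2ℓ}` (`T = exp{𝓛^{1.1}}`, `𝓛^{1.1} ≥ 𝓛`). [cite: Zhang2022LandauSiegel, §2 p. 5] -/
theorem exp_two_mul_ell_le_bigT_sq (hℓ : 1 ≤ ell D) :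
    1 ≤ bigT D ∧ Real.exp (2 * ell D) ≤ bigT D ^ 2 := by
  have h1 : ell D ≤ ell D ^ (1.1 : ℝ) := by
    calc ell D = ell D ^ (1 : ℝ) := (Real.rpow_one _).symm
      _ ≤ ell D ^ (1.1 : ℝ) := Real.rpow_le_rpow_of_exponent_le hℓ (by norm_num)
  refine ⟨?_, ?_⟩
  · rw [bigT]; exact Real.one_le_exp (by linarith)
  · rw [bigT, ← Real.exp_nat_mul]
    exact Real.exp_le_exp.mpr (by push_cast; linarith)

/-- `ℓ ≥ 3 ⇒ P/T² ≥ 2` (`P/T² = exp{𝓛⁹ − 2𝓛^{1.1}} ≥ exp{𝓛⁹ − 2𝓛²} ≥ e`). [cite: Zhang2022LandauSiegel, §2 p. 5] -/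
theorem two_le_bigP_div_bigT_sq (hℓ : 3 ≤ ell D) : 2 ≤ bigP D / bigT D ^ 2 := by
  have hℓ1 : 1 ≤ ell D := by linarith
  have h2 : ell D ^ (1.1 : ℝ) ≤ ell D ^ 2 := by
    calc ell D ^ (1.1 : ℝ) ≤ ell D ^ (2 : ℝ) := Real.rpow_le_rpow_of_exponent_le hℓ1 (by norm_num)
      _ = ell D ^ 2 := by norm_cast
  have hT : bigT D ^ 2 = Real.exp (2 * ell D ^ (1.1 : ℝ)) := by rw [bigT, ← Real.exp_nat_mul]; push_cast; ring_nf
  rw [hT, bigP, ← Real.exp_sub, ge_iff_le.symm]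
  have h9 : ell D ^ 9 - 2 * ell D ^ 2 ≥ 1 := by
    have h3 : (9 : ℝ) ≤ ell D ^ 2 := by nlinarith
    have h4 : ell D ^ 9 = ell D ^ 2 * ell D ^ 7 := by ring
    have h5 : (3 : ℝ) ^ 7 ≤ ell D ^ 7 := pow_le_pow_left₀ (by norm_num) hℓ 7
    nlinarith
  calc (2 : ℝ) ≤ Real.exp 1 := by have := Real.add_one_le_exp (1 : ℝ); linarith
    _ ≤ Real.exp (ell D ^ 9 - 2 * ell D ^ (1.1 : ℝ)) := Real.exp_le_exp.mpr (by linarith)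

/-- `ℓ ≥ 1 ⇒ D ≤ P` (`D = e^𝓛 ≤ e^{𝓛⁹} = P`). [cite: Zhang2022LandauSiegel, §2 (2.6) p. 5] -/
theorem natCast_le_bigP (hℓ : 1 ≤ ell D) : (D : ℝ) ≤ bigP D := by
  have hD : (0 : ℝ) < D := by
    rcases Nat.eq_zero_or_pos D with h | h
    · exfalso
      have : 0 < ell D := by linarith
      rw [ell, h, Nat.cast_zero, Real.log_zero] at this
      exact lt_irrefl _ this
    · exact_mod_cast h
  calc (D : ℝ) = Real.exp (ell D) := by rw [ell, Real.exp_log hD]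
    _ ≤ bigP D := by
        rw [bigP]
        exact Real.exp_le_exp.mpr (le_self_pow₀ hℓ (by norm_num))

/-- The support bound `N_b = ⌈PT⁻²⌉` of `b`: for `ℓ ≥ 3`, `2 ≤ N_b ≤ P` and `N_b − 1 ≤ PT⁻²`.
[cite: Zhang2022LandauSiegel, §15 (15.2) p. 79] -/
theorem Nb_bounds (hℓ : 3 ≤ ell D) :
    2 ≤ ⌈bigP D / bigT D ^ 2⌉₊ ∧ (⌈bigP D / bigT D ^ 2⌉₊ : ℝ) ≤ bigP D ∧
      ((⌈bigP D / bigT D ^ 2⌉₊ - 1 : ℕ) : ℝ) ≤ bigP D / bigT D ^ 2 := by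
  have hℓ1 : 1 ≤ ell D := by linarith
  obtain ⟨hT1, hT2⟩ := exp_two_mul_ell_le_bigT_sq hℓ1
  have hPT := two_le_bigP_div_bigT_sq hℓ
  have hP0 : 0 < bigP D := Real.exp_pos _
  have hx0 : 0 ≤ bigP D / bigT D ^ 2 := by positivity
  have hNb2 : 2 ≤ ⌈bigP D / bigT D ^ 2⌉₊ := by
    have h : (2 : ℝ) ≤ ⌈bigP D / bigT D ^ 2⌉₊ := hPT.trans (Nat.le_ceil _)
    exact_mod_cast h
  have hlt : (⌈bigP D / bigT D ^ 2⌉₊ : ℝ) < bigP D / bigT D ^ 2 + 1 := Nat.ceil_lt_add_one hx0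
  refine ⟨hNb2, ?_, ?_⟩
  · have hT4 : 4 ≤ bigT D ^ 2 := by
      have h6 : (4 : ℝ) ≤ Real.exp (2 * ell D) := by
        calc (4 : ℝ) ≤ 2 * ell D + 1 := by linarith
          _ ≤ Real.exp (2 * ell D) := Real.add_one_le_exp _
      exact h6.trans hT2
    have h1 : bigP D / bigT D ^ 2 ≤ bigP D / 4 := div_le_div_of_nonneg_left hP0.le (by norm_num) hT4
    have h2 : 2 * bigT D ^ 2 ≤ bigP D := by rwa [le_div_iff₀ (by positivity)] at hPT
    nlinarith
  · rw [Nat.cast_sub (by omega), Nat.cast_one]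
    linarith

/-- Window primes exceed `P`, are at most `2P`, and exceed `N_b − 1`. [cite: Zhang2022LandauSiegel, §2 p. 4] -/
theorem Nb_pred_lt_of_mem_primeWindow (hℓ : 3 ≤ ell D) {p : ℕ} (hp : p ∈ primeWindow D) :
    ⌈bigP D / bigT D ^ 2⌉₊ - 1 < p := by
  obtain ⟨-, -, h3⟩ := Nb_bounds hℓ
  have hℓ1 : 1 ≤ ell D := by linarith
  obtain ⟨hT1, -⟩ := exp_two_mul_ell_le_bigT_sq hℓ1
  have hP := bigP_lt_of_mem_primeWindow hp
  have hP0 : 0 < bigP D := Real.exp_pos _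
  have h4 : bigP D / bigT D ^ 2 ≤ bigP D := div_le_self hP0.le (one_le_pow₀ hT1)
  exact_mod_cast (h3.trans h4).trans_lt hP

end Sizes

section Terms

variable (c' : ℝ) {D : ℕ} [NeZero D] (χ : DirichletCharacter ℂ D)

omit [NeZero D] in
/-- `log 3 ≤ 2`. [folklore] -/
private theorem log_three_le_two : Real.log 3 ≤ 2 := by
  have h : (3 : ℝ) ≤ Real.exp 2 := by
    have h1 := Real.add_one_le_exp (1 : ℝ)
    have h2 : Real.exp 2 = Real.exp 1 * Real.exp 1 := by rw [← Real.exp_add]; norm_num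
    nlinarith [Real.exp_pos 1]
  calc Real.log 3 ≤ Real.log (Real.exp 2) := Real.log_le_log (by norm_num) h
    _ = 2 := Real.log_exp 2

omit [NeZero D] in
/-- For `1 ≤ x ≤ 3P` and `ℓ ≥ 3`: `1 + log x ≤ 3𝓛⁹` (`log 3P = log 3 + 𝓛⁹`). [cite: Zhang2022LandauSiegel, §2 (2.6)] -/
theorem one_add_log_le (hℓ : 3 ≤ ell D) {x : ℝ} (hx1 : 1 ≤ x) (hx : x ≤ 3 * bigP D) :
    0 ≤ 1 + Real.log x ∧ 1 + Real.log x ≤ 3 * ell D ^ 9 := by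
  have hlog0 : 0 ≤ Real.log x := Real.log_nonneg hx1
  have h9 : (3 : ℝ) ^ 9 ≤ ell D ^ 9 := pow_le_pow_left₀ (by norm_num) hℓ 9
  refine ⟨by linarith, ?_⟩
  have h1 : Real.log x ≤ Real.log 3 + ell D ^ 9 := by
    calc Real.log x ≤ Real.log (3 * bigP D) := Real.log_le_log (by linarith) hx
      _ = Real.log 3 + ell D ^ 9 := by
          rw [bigP, Real.log_mul (by norm_num) (Real.exp_pos _).ne', Real.log_exp]
  linarith [log_three_le_two]

/-- **Term 1 (near terms)** of the three-regime bound for (15.4):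
`(Σ_{j<p}|a⁰(j)|j^{−1/2})(Σ_n |b(n)χ(n)|n^{−1/2}) ≤ 2187·C_b·P𝓛⁵⁴/D ≤ 2187·C_b·PD^{−4/5}`
once `𝓛⁵⁴ ≤ D^{1/5}`. [cite: Zhang2022LandauSiegel, §15 p. 81] -/
theorem term1_le (hℓ : 3 ≤ ell D) {p : ℕ} (hp : p ∈ primeWindow D)
    (hD₁ : Real.log D ^ 54 * (D : ℝ) ^ (-(1 / 5 : ℝ)) ≤ 1) :
    (∑ j ∈ Finset.range p, ‖(if D ∣ j then ktilde c' D (j / D) else 0)‖ * (j : ℝ) ^ (-(1 / 2 : ℝ))) *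
        (∑ n ∈ Finset.Ico 1 ⌈bigP D / bigT D ^ 2⌉₊,
          ‖bcoef D n * χ (n : ZMod D)‖ * (n : ℝ) ^ (-(1 / 2 : ℝ)))
      ≤ (1 + ‖iota2‖) * (‖iota3‖ + ‖iota4‖) * 2187 * bigP D * (D : ℝ) ^ (-(4 / 5 : ℝ)) := by
  have hℓ1 : 1 ≤ ell D := by linarith
  have hℓ0 : 0 < ell D := by linarith
  have hD2 : 2 ≤ Real.log D := by change 2 ≤ ell D; linarith
  have hD0 : (0 : ℝ) < D := by
    have := natCast_le_bigP hℓ1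
    rcases Nat.eq_zero_or_pos D with h | h
    · exact absurd (NeZero.ne D) (by simp [h])
    · exact_mod_cast h
  set Cb : ℝ := (1 + ‖iota2‖) * (‖iota3‖ + ‖iota4‖) with hCb
  have hCb0 : 0 ≤ Cb := by positivity
  set Nb : ℕ := ⌈bigP D / bigT D ^ 2⌉₊ with hNb
  set M : ℕ := ⌈(p : ℝ) / D⌉₊ with hM
  have hP0 : 0 < bigP D := Real.exp_pos _
  have hPD := natCast_le_bigP (D := D) hℓ1
  have hp2 := le_two_mul_bigP_of_mem_primeWindow hℓ1 hp
  have hpP := bigP_lt_of_mem_primeWindow hp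
  obtain ⟨hNb2, hNbP, -⟩ := Nb_bounds hℓ
  -- the two factors
  have hA := sum_range_norm_aCoeff_rpow_le c' hℓ0 p
  have hB := sum_norm_bCoeff_rpow_neg_le χ hD2 Nb
  have hA0 : 0 ≤ ∑ j ∈ Finset.range p,
      ‖(if D ∣ j then ktilde c' D (j / D) else 0)‖ * (j : ℝ) ^ (-(1 / 2 : ℝ)) :=
    Finset.sum_nonneg fun j _ => by positivity
  have hB0 : 0 ≤ ∑ n ∈ Finset.Ico 1 Nb, ‖bcoef D n * χ (n : ZMod D)‖ * (n : ℝ) ^ (-(1 / 2 : ℝ)) :=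
    Finset.sum_nonneg fun n _ => by positivity
  -- sizes of `M` and `N_b`
  have hM1 : (1 : ℝ) ≤ M := by
    have : 0 < M := Nat.ceil_pos.mpr (div_pos (hP0.trans hpP) hD0)
    exact_mod_cast this
  have hM3 : (M : ℝ) ≤ 3 * bigP D / D := by
    have h1 : (M : ℝ) < (p : ℝ) / D + 1 := Nat.ceil_lt_add_one (by positivity)
    have h2 : (p : ℝ) / D ≤ 2 * bigP D / D := div_le_div_of_nonneg_right hp2 hD0.le
    have h3 : (1 : ℝ) ≤ bigP D / D := by rw [le_div_iff₀ hD0, one_mul]; exact hPD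
    have h4 : 3 * bigP D / D = 2 * bigP D / D + bigP D / D := by ring
    linarith
  have hM3P : (M : ℝ) ≤ 3 * bigP D := by
    have hD1 : (1 : ℝ) ≤ D := by exact_mod_cast Nat.one_le_iff_ne_zero.mpr (NeZero.ne D)
    calc (M : ℝ) ≤ 3 * bigP D / D := hM3
      _ ≤ 3 * bigP D := div_le_self (by positivity) hD1
  have hNb1 : (1 : ℝ) ≤ Nb := by exact_mod_cast (show 1 ≤ Nb by omega)
  have hNb3P : (Nb : ℝ) ≤ 3 * bigP D := by linarith
  obtain ⟨hLM0, hLM⟩ := one_add_log_le hℓ hM1 hM3P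
  obtain ⟨hLN0, hLN⟩ := one_add_log_le hℓ hNb1 hNb3P
  -- the square roots
  have hsq : (D : ℝ) ^ (-(1 / 2 : ℝ)) * ((M : ℝ) ^ (1 / 2 : ℝ) * (Nb : ℝ) ^ (1 / 2 : ℝ)) ≤ 3 * bigP D / D := by
    have e1 : (M : ℝ) ^ (1 / 2 : ℝ) * (Nb : ℝ) ^ (1 / 2 : ℝ) = ((M : ℝ) * Nb) ^ (1 / 2 : ℝ) :=
      (Real.mul_rpow (by positivity) (by positivity)).symm
    have e2 : ((M : ℝ) * Nb) ^ (1 / 2 : ℝ) ≤ (9 * bigP D ^ 2 / D) ^ (1 / 2 : ℝ) := by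
      refine Real.rpow_le_rpow (by positivity) ?_ (by norm_num)
      calc (M : ℝ) * Nb ≤ (3 * bigP D / D) * bigP D := mul_le_mul hM3 hNbP (by positivity) (by positivity)
        _ ≤ 9 * bigP D ^ 2 / D := by
            rw [div_mul_eq_mul_div, div_le_div_iff_of_pos_right hD0]; nlinarith
    have e3 : (9 * bigP D ^ 2 / D) ^ (1 / 2 : ℝ) = 3 * bigP D * (D : ℝ) ^ (-(1 / 2 : ℝ)) := by
      rw [show 9 * bigP D ^ 2 / D = (3 * bigP D) ^ 2 * (D : ℝ)⁻¹ by ring,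
        Real.mul_rpow (by positivity) (by positivity), Real.inv_rpow hD0.le, ← Real.rpow_neg hD0.le,
        show ((3 * bigP D) ^ 2 : ℝ) = (3 * bigP D) ^ (2 : ℝ) by norm_cast, ← Real.rpow_mul (by positivity)]
      norm_num
    have e4 : (D : ℝ) ^ (-(1 / 2 : ℝ)) * (3 * bigP D * (D : ℝ) ^ (-(1 / 2 : ℝ))) = 3 * bigP D / D := by
      rw [show (D : ℝ) ^ (-(1 / 2 : ℝ)) * (3 * bigP D * (D : ℝ) ^ (-(1 / 2 : ℝ)))
          = 3 * bigP D * ((D : ℝ) ^ (-(1 / 2 : ℝ)) * (D : ℝ) ^ (-(1 / 2 : ℝ))) by ring,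
        ← Real.rpow_add hD0, show (-(1 / 2 : ℝ)) + -(1 / 2 : ℝ) = -1 by norm_num, Real.rpow_neg_one,
        div_eq_mul_inv]
    rw [e1]
    calc (D : ℝ) ^ (-(1 / 2 : ℝ)) * ((M : ℝ) * Nb) ^ (1 / 2 : ℝ)
        ≤ (D : ℝ) ^ (-(1 / 2 : ℝ)) * (9 * bigP D ^ 2 / D) ^ (1 / 2 : ℝ) :=
          mul_le_mul_of_nonneg_left e2 (by positivity)
      _ = 3 * bigP D / D := by rw [e3, e4]
  -- the logarithms
  have hlogs : (1 + Real.log (M : ℕ)) ^ 4 * (1 + Real.log (Nb : ℕ)) ^ 2 ≤ 729 * ell D ^ 54 := by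
    calc (1 + Real.log (M : ℕ)) ^ 4 * (1 + Real.log (Nb : ℕ)) ^ 2
        ≤ (3 * ell D ^ 9) ^ 4 * (3 * ell D ^ 9) ^ 2 :=
          mul_le_mul (pow_le_pow_left₀ hLM0 hLM 4) (pow_le_pow_left₀ hLN0 hLN 2) (by positivity)
            (by positivity)
      _ = 729 * ell D ^ 54 := by ring
  -- `𝓛⁵⁴/D ≤ D^{−4/5}`
  have hDsplit : ell D ^ 54 / D ≤ (D : ℝ) ^ (-(4 / 5 : ℝ)) := by
    have e : (D : ℝ)⁻¹ = (D : ℝ) ^ (-(1 / 5 : ℝ)) * (D : ℝ) ^ (-(4 / 5 : ℝ)) := by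
      rw [← Real.rpow_add hD0, show (-(1 / 5 : ℝ)) + -(4 / 5 : ℝ) = -1 by norm_num, Real.rpow_neg_one]
    rw [div_eq_mul_inv, e, ← mul_assoc]
    have h54 : Real.log D ^ 54 = ell D ^ 54 := rfl
    rw [← h54]
    exact mul_le_of_le_one_left (by positivity) hD₁
  -- assemble
  calc _ ≤ ((D : ℝ) ^ (-(1 / 2 : ℝ)) * ((M : ℝ) ^ (1 / 2 : ℝ) * (1 + Real.log (M : ℕ)) ^ 4)) *
          (Cb * ((Nb : ℝ) ^ (1 / 2 : ℝ) * (1 + Real.log (Nb : ℕ)) ^ 2)) :=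
        mul_le_mul hA hB hB0 (by positivity)
    _ = Cb * ((D : ℝ) ^ (-(1 / 2 : ℝ)) * ((M : ℝ) ^ (1 / 2 : ℝ) * (Nb : ℝ) ^ (1 / 2 : ℝ))) *
          ((1 + Real.log (M : ℕ)) ^ 4 * (1 + Real.log (Nb : ℕ)) ^ 2) := by ring
    _ ≤ Cb * (3 * bigP D / D) * (729 * ell D ^ 54) :=
        mul_le_mul (mul_le_mul_of_nonneg_left hsq hCb0) hlogs (by positivity) (by positivity)
    _ = Cb * 2187 * bigP D * (ell D ^ 54 / D) := by ring
    _ ≤ Cb * 2187 * bigP D * (D : ℝ) ^ (-(4 / 5 : ℝ)) :=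
        mul_le_mul_of_nonneg_left hDsplit (by positivity)

/-- **Term 2 (diagonal)**: `(p−1)·C_bτ₂(D)K(log N_b)¹⁶/D ≤ 2C_bC_τK·P·𝓛¹⁴⁴D^{−9/10} ≤ 2C_bC_τK·PD^{−4/5}`
once `𝓛¹⁴⁴ ≤ D^{1/10}` (`τ₂(D) ≤ C_τD^{1/10}`). [cite: Zhang2022LandauSiegel, §15 p. 81] -/
theorem term2_le (hℓ : 3 ≤ ell D) {p : ℕ} (hp : p ∈ primeWindow D) {Cτ : ℝ}
    (hCτ : ∀ n : ℕ, MeanSquareMajorant.tau 2 n ≤ Cτ * (n : ℝ) ^ (1 / 10 : ℝ))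
    (hD₂ : Real.log D ^ 144 * (D : ℝ) ^ (-(1 / 10 : ℝ)) ≤ 1) :
    ((p : ℝ) - 1) * ∑ n ∈ Finset.Ico 1 ⌈bigP D / bigT D ^ 2⌉₊,
        ‖(if D ∣ n then ktilde c' D (n / D) else 0)‖ * ‖bcoef D n * χ (n : ZMod D)‖ / n
      ≤ (1 + ‖iota2‖) * (‖iota3‖ + ‖iota4‖) * (2 * Cτ * MeanSquareMajorant.majorantConst 16 8) *
          bigP D * (D : ℝ) ^ (-(4 / 5 : ℝ)) := by
  have hℓ1 : 1 ≤ ell D := by linarith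
  have hℓ0 : 0 < ell D := by linarith
  have hD2 : 2 ≤ Real.log D := by change 2 ≤ ell D; linarith
  have hD0 : (0 : ℝ) < D := by
    rcases Nat.eq_zero_or_pos D with h | h
    · exact absurd (NeZero.ne D) (by simp [h])
    · exact_mod_cast h
  set Cb : ℝ := (1 + ‖iota2‖) * (‖iota3‖ + ‖iota4‖) with hCb
  set K : ℝ := MeanSquareMajorant.majorantConst 16 8 with hK
  have hCb0 : 0 ≤ Cb := by positivity
  have hK0 : 0 ≤ K := (MeanSquareMajorant.majorantConst_pos 16 8).le
  have hCτ0 : 0 ≤ Cτ := by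
    have h := hCτ 1
    rw [Nat.cast_one, Real.one_rpow, mul_one, MeanSquareMajorant.tau_apply_one] at h
    linarith
  set Nb : ℕ := ⌈bigP D / bigT D ^ 2⌉₊ with hNb
  have hP0 : 0 < bigP D := Real.exp_pos _
  have hp2 := le_two_mul_bigP_of_mem_primeWindow hℓ1 hp
  obtain ⟨hNb2, hNbP, -⟩ := Nb_bounds hℓ
  have hS := sum_norm_aCoeff_bCoeff_div_le c' χ hℓ0 hD2 hNb2
  have hS0 : 0 ≤ ∑ n ∈ Finset.Ico 1 Nb,
      ‖(if D ∣ n then ktilde c' D (n / D) else 0)‖ * ‖bcoef D n * χ (n : ZMod D)‖ / n :=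
    Finset.sum_nonneg fun n _ => by positivity
  have hp1 : (p : ℝ) - 1 ≤ 2 * bigP D := by linarith
  have hp10 : 0 ≤ (p : ℝ) - 1 := by
    have := (Finset.mem_filter.mp hp).2.one_lt
    have : (1 : ℝ) < p := by exact_mod_cast this
    linarith
  -- `(log N_b)^16 ≤ 𝓛¹⁴⁴`
  have hlogNb : Real.log (Nb : ℕ) ^ 16 ≤ ell D ^ 144 := by
    have h0 : 0 ≤ Real.log (Nb : ℕ) := Real.log_natCast_nonneg _
    have h1 : Real.log (Nb : ℕ) ≤ ell D ^ 9 := by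
      calc Real.log (Nb : ℕ) ≤ Real.log (bigP D) := Real.log_le_log (by positivity) hNbP
        _ = ell D ^ 9 := by rw [bigP, Real.log_exp]
    calc Real.log (Nb : ℕ) ^ 16 ≤ (ell D ^ 9) ^ 16 := pow_le_pow_left₀ h0 h1 16
      _ = ell D ^ 144 := by ring
  -- `τ₂(D)/D ≤ C_τ D^{−1/10} D^{−4/5}`
  have htauD : MeanSquareMajorant.tau 2 D * (D : ℝ)⁻¹ ≤ Cτ * ((D : ℝ) ^ (-(1 / 10 : ℝ)) * (D : ℝ) ^ (-(4 / 5 : ℝ))) := by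
    have e : (D : ℝ) ^ (1 / 10 : ℝ) * (D : ℝ)⁻¹ = (D : ℝ) ^ (-(1 / 10 : ℝ)) * (D : ℝ) ^ (-(4 / 5 : ℝ)) := by
      rw [← Real.rpow_neg_one, ← Real.rpow_add hD0, ← Real.rpow_add hD0]; norm_num
    calc MeanSquareMajorant.tau 2 D * (D : ℝ)⁻¹ ≤ Cτ * (D : ℝ) ^ (1 / 10 : ℝ) * (D : ℝ)⁻¹ :=
          mul_le_mul_of_nonneg_right (hCτ D) (by positivity)
      _ = Cτ * ((D : ℝ) ^ (-(1 / 10 : ℝ)) * (D : ℝ) ^ (-(4 / 5 : ℝ))) := by rw [mul_assoc, e]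
  have hmain : MeanSquareMajorant.tau 2 D * (D : ℝ)⁻¹ * (K * Real.log (Nb : ℕ) ^ 16)
      ≤ Cτ * K * (D : ℝ) ^ (-(4 / 5 : ℝ)) := by
    calc MeanSquareMajorant.tau 2 D * (D : ℝ)⁻¹ * (K * Real.log (Nb : ℕ) ^ 16)
        ≤ Cτ * ((D : ℝ) ^ (-(1 / 10 : ℝ)) * (D : ℝ) ^ (-(4 / 5 : ℝ))) * (K * ell D ^ 144) :=
          mul_le_mul htauD (mul_le_mul_of_nonneg_left hlogNb hK0) (by positivity) (by positivity)
      _ = Cτ * K * (D : ℝ) ^ (-(4 / 5 : ℝ)) * (Real.log D ^ 144 * (D : ℝ) ^ (-(1 / 10 : ℝ))) := by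
          rw [show Real.log D = ell D from rfl]; ring
      _ ≤ Cτ * K * (D : ℝ) ^ (-(4 / 5 : ℝ)) * 1 := mul_le_mul_of_nonneg_left hD₂ (by positivity)
      _ = Cτ * K * (D : ℝ) ^ (-(4 / 5 : ℝ)) := mul_one _
  calc _ ≤ (2 * bigP D) * (Cb * (MeanSquareMajorant.tau 2 D * (D : ℝ)⁻¹ * (K * Real.log (Nb : ℕ) ^ 16))) :=
        mul_le_mul hp1 hS hS0 (by positivity)
    _ ≤ (2 * bigP D) * (Cb * (Cτ * K * (D : ℝ) ^ (-(4 / 5 : ℝ)))) :=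
        mul_le_mul_of_nonneg_left (mul_le_mul_of_nonneg_left hmain hCb0) (by positivity)
    _ = Cb * (2 * Cτ * K) * bigP D * (D : ℝ) ^ (-(4 / 5 : ℝ)) := by ring

omit [NeZero D] in
/-- **The far Gaussian factor is negligible**: for `ℓ ≥ 3`, `p ∼ P`, `N = N_b − 1`:
`u₀ = log(p/N) ≥ 2𝓛` (as `p/N ≥ T² ≥ e^{2𝓛}`), hence `𝓛₂²u₀ ≥ 1` and `u₀(𝓛₂²u₀ − 1) ≥ 2𝓛⁸⁰¹`.
[cite: Zhang2022LandauSiegel, §15 p. 81] -/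
theorem u0_bounds (hℓ : 3 ≤ ell D) {p : ℕ} (hp : p ∈ primeWindow D) :
    2 * ell D ≤ Real.log ((p : ℝ) / ((⌈bigP D / bigT D ^ 2⌉₊ - 1 : ℕ) : ℝ)) ∧
    1 ≤ ell2 D ^ 2 * Real.log ((p : ℝ) / ((⌈bigP D / bigT D ^ 2⌉₊ - 1 : ℕ) : ℝ)) ∧
    2 * ell D ^ 801 ≤ Real.log ((p : ℝ) / ((⌈bigP D / bigT D ^ 2⌉₊ - 1 : ℕ) : ℝ)) *
      (ell2 D ^ 2 * Real.log ((p : ℝ) / ((⌈bigP D / bigT D ^ 2⌉₊ - 1 : ℕ) : ℝ)) - 1) := by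
  have hℓ1 : 1 ≤ ell D := by linarith
  obtain ⟨hT1, hT2⟩ := exp_two_mul_ell_le_bigT_sq hℓ1
  obtain ⟨hNb2, -, hN⟩ := Nb_bounds hℓ
  have hP0 : 0 < bigP D := Real.exp_pos _
  have hpP := bigP_lt_of_mem_primeWindow hp
  set N : ℕ := ⌈bigP D / bigT D ^ 2⌉₊ - 1 with hNdef
  have hN0 : (0 : ℝ) < N := by exact_mod_cast (show 0 < N by omega)
  have hT0 : 0 < bigT D ^ 2 := by positivity
  -- `e^{2ℓ} ≤ p/N`
  have hq : Real.exp (2 * ell D) ≤ (p : ℝ) / N := by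
    rw [le_div_iff₀ hN0]
    calc Real.exp (2 * ell D) * N ≤ bigT D ^ 2 * (bigP D / bigT D ^ 2) :=
          mul_le_mul hT2 hN hN0.le hT0.le
      _ = bigP D := by field_simp
      _ ≤ p := hpP.le
  set u₀ : ℝ := Real.log ((p : ℝ) / N) with hu₀
  have hu : 2 * ell D ≤ u₀ := by
    calc 2 * ell D = Real.log (Real.exp (2 * ell D)) := (Real.log_exp _).symm
      _ ≤ u₀ := Real.log_le_log (Real.exp_pos _) hq
  have hL2 : ell2 D ^ 2 = ell D ^ 800 := by rw [ell2, ← pow_mul]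
  have h800 : 1 ≤ ell D ^ 800 := one_le_pow₀ hℓ1
  have h801 : ell D ^ 801 = ell D ^ 800 * ell D := by ring
  refine ⟨hu, ?_, ?_⟩
  · rw [hL2]; nlinarith
  · rw [hL2]
    -- `u₀(ℓ⁸⁰⁰u₀ − 1) ≥ 2ℓ(2ℓ⁸⁰¹ − 1) ≥ 2ℓ⁸⁰¹`
    have h1 : ell D ^ 800 * u₀ - 1 ≥ ell D ^ 801 := by nlinarith
    have h2 : 0 ≤ ell D ^ 800 * u₀ - 1 := by nlinarith
    have h3 : 0 ≤ ell D ^ 801 := by positivity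
    calc 2 * ell D ^ 801 = (2 * 1) * ell D ^ 801 := by ring
      _ ≤ (2 * ell D) * ell D ^ 801 := mul_le_mul_of_nonneg_right (by linarith) h3
      _ ≤ u₀ * (ell D ^ 800 * u₀ - 1) := mul_le_mul hu h1 h3 (by linarith)

/-- **Term 3 (far terms `j ≥ p`)**: `(p−1)·Z·C_bN_b^{3/2}(1+log N_b)²·e^{−u₀(𝓛₂²u₀−1)} ≤ 8ZC_b·PD^{−4/5}`
(`N_b ≤ P`, `e^{−2𝓛⁸⁰¹}` absorbs `P^{3/2}𝓛¹⁸D^{4/5}`). [cite: Zhang2022LandauSiegel, §15 p. 81] -/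
theorem term3_le (hℓ : 3 ≤ ell D) {p : ℕ} (hp : p ∈ primeWindow D) {Z : ℝ} (hZ : 0 ≤ Z) :
    ((p : ℝ) - 1) * (Z * (∑ n ∈ Finset.Ico 1 ⌈bigP D / bigT D ^ 2⌉₊,
          ‖bcoef D n * χ (n : ZMod D)‖ * (n : ℝ) ^ (1 / 2 : ℝ)) *
        Real.exp (-(Real.log ((p : ℝ) / ((⌈bigP D / bigT D ^ 2⌉₊ - 1 : ℕ) : ℝ)) *
          (ell2 D ^ 2 * Real.log ((p : ℝ) / ((⌈bigP D / bigT D ^ 2⌉₊ - 1 : ℕ) : ℝ)) - 1))))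
      ≤ (1 + ‖iota2‖) * (‖iota3‖ + ‖iota4‖) * (8 * Z) * bigP D * (D : ℝ) ^ (-(4 / 5 : ℝ)) := by
  have hℓ1 : 1 ≤ ell D := by linarith
  have hℓ0 : 0 < ell D := by linarith
  have hD2 : 2 ≤ Real.log D := by change 2 ≤ ell D; linarith
  have hD0 : (0 : ℝ) < D := by
    rcases Nat.eq_zero_or_pos D with h | h
    · exact absurd (NeZero.ne D) (by simp [h])
    · exact_mod_cast h
  set Cb : ℝ := (1 + ‖iota2‖) * (‖iota3‖ + ‖iota4‖) with hCb
  have hCb0 : 0 ≤ Cb := by positivity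
  set Nb : ℕ := ⌈bigP D / bigT D ^ 2⌉₊ with hNb
  have hP0 : 0 < bigP D := Real.exp_pos _
  have hp2 := le_two_mul_bigP_of_mem_primeWindow hℓ1 hp
  obtain ⟨hNb2, hNbP, -⟩ := Nb_bounds hℓ
  obtain ⟨-, -, hexpo⟩ := u0_bounds hℓ hp
  have hB := sum_norm_bCoeff_rpow_le χ hD2 Nb
  have hB0 : 0 ≤ ∑ n ∈ Finset.Ico 1 Nb, ‖bcoef D n * χ (n : ZMod D)‖ * (n : ℝ) ^ (1 / 2 : ℝ) :=
    Finset.sum_nonneg fun n _ => by positivity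
  have hp1 : (p : ℝ) - 1 ≤ 2 * bigP D := by linarith
  have hp10 : 0 ≤ (p : ℝ) - 1 := by
    have := (Finset.mem_filter.mp hp).2.one_lt
    have : (1 : ℝ) < p := by exact_mod_cast this
    linarith
  set E : ℝ := Real.exp (-(Real.log ((p : ℝ) / ((Nb - 1 : ℕ) : ℝ)) *
    (ell2 D ^ 2 * Real.log ((p : ℝ) / ((Nb - 1 : ℕ) : ℝ)) - 1))) with hE
  have hE : E ≤ Real.exp (-(2 * ell D ^ 801)) := Real.exp_le_exp.mpr (by linarith)
  have hE0 : 0 ≤ E := (Real.exp_pos _).le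
  -- `N_b^{3/2} ≤ P^{3/2} = e^{(3/2)𝓛⁹}`, `(1 + log N_b)² ≤ 4𝓛¹⁸ ≤ 4e^{18𝓛⁹}`
  have hNb32 : (Nb : ℝ) ^ (3 / 2 : ℝ) ≤ Real.exp (3 / 2 * ell D ^ 9) := by
    calc (Nb : ℝ) ^ (3 / 2 : ℝ) ≤ bigP D ^ (3 / 2 : ℝ) := Real.rpow_le_rpow (by positivity) hNbP (by norm_num)
      _ = Real.exp (3 / 2 * ell D ^ 9) := by rw [bigP, ← Real.exp_mul, mul_comm]
  have hNb1 : (1 : ℝ) ≤ Nb := by exact_mod_cast (show 1 ≤ Nb by omega)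
  have hlog : (1 + Real.log (Nb : ℕ)) ^ 2 ≤ 4 * Real.exp (18 * ell D ^ 9) := by
    have h0 : 0 ≤ Real.log (Nb : ℕ) := Real.log_natCast_nonneg _
    have h1 : Real.log (Nb : ℕ) ≤ ell D ^ 9 := by
      calc Real.log (Nb : ℕ) ≤ Real.log (bigP D) := Real.log_le_log (by positivity) hNbP
        _ = ell D ^ 9 := by rw [bigP, Real.log_exp]
    have h9 : 1 ≤ ell D ^ 9 := one_le_pow₀ hℓ1
    have h2 : 1 + Real.log (Nb : ℕ) ≤ 2 * ell D ^ 9 := by linarith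
    have h3 : ell D ^ 9 ≤ Real.exp (ell D ^ 9) := by
      have := Real.add_one_le_exp (ell D ^ 9); linarith
    have h4 : (ell D ^ 9) ^ 2 ≤ Real.exp (18 * ell D ^ 9) := by
      calc (ell D ^ 9) ^ 2 ≤ Real.exp (ell D ^ 9) ^ 2 := pow_le_pow_left₀ (by positivity) h3 2
        _ = Real.exp (2 * ell D ^ 9) := by rw [← Real.exp_nat_mul]; norm_num
        _ ≤ Real.exp (18 * ell D ^ 9) := Real.exp_le_exp.mpr (by nlinarith)
    calc (1 + Real.log (Nb : ℕ)) ^ 2 ≤ (2 * ell D ^ 9) ^ 2 := pow_le_pow_left₀ (by linarith) h2 2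
      _ = 4 * (ell D ^ 9) ^ 2 := by ring
      _ ≤ 4 * Real.exp (18 * ell D ^ 9) := by linarith
  -- the exponential bookkeeping: `e^{1.5𝓛⁹}·e^{18𝓛⁹}·e^{−2𝓛⁸⁰¹} ≤ D^{−4/5} = e^{−(4/5)𝓛}`
  have hexp : Real.exp (3 / 2 * ell D ^ 9) * Real.exp (18 * ell D ^ 9) * Real.exp (-(2 * ell D ^ 801))
      ≤ (D : ℝ) ^ (-(4 / 5 : ℝ)) := by
    rw [← Real.exp_add, ← Real.exp_add, Real.rpow_def_of_pos hD0, show Real.log D = ell D from rfl]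
    refine Real.exp_le_exp.mpr ?_
    have h792 : (27 : ℝ) ≤ ell D ^ 792 := by
      calc (27 : ℝ) = 3 ^ 3 := by norm_num
        _ ≤ ell D ^ 3 := pow_le_pow_left₀ (by norm_num) hℓ 3
        _ ≤ ell D ^ 792 := pow_le_pow_right₀ hℓ1 (by norm_num)
    have h801 : ell D ^ 801 = ell D ^ 9 * ell D ^ 792 := by ring
    have h9 : ell D ≤ ell D ^ 9 := le_self_pow₀ hℓ1 (by norm_num)
    have h90 : 0 ≤ ell D ^ 9 := by positivity
    nlinarith
  calc _ ≤ (2 * bigP D) * (Z * (Cb * ((Nb : ℝ) ^ (3 / 2 : ℝ) * (1 + Real.log (Nb : ℕ)) ^ 2)) *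
          Real.exp (-(2 * ell D ^ 801))) := by
        refine mul_le_mul hp1 ?_ (by positivity) (by positivity)
        exact mul_le_mul (mul_le_mul_of_nonneg_left hB hZ) hE hE0 (by positivity)
    _ ≤ (2 * bigP D) * (Z * (Cb * (Real.exp (3 / 2 * ell D ^ 9) * (4 * Real.exp (18 * ell D ^ 9)))) *
          Real.exp (-(2 * ell D ^ 801))) := by
        gcongr
    _ = Cb * (8 * Z) * bigP D *
          (Real.exp (3 / 2 * ell D ^ 9) * Real.exp (18 * ell D ^ 9) * Real.exp (-(2 * ell D ^ 801))) := by
        ring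
    _ ≤ Cb * (8 * Z) * bigP D * (D : ℝ) ^ (-(4 / 5 : ℝ)) :=
        mul_le_mul_of_nonneg_left hexp (by positivity)

end Terms

section Final

open Filter Topology

/-- `(log D)^k · D^{−c} → 0`. [folklore] -/
private theorem tendsto_log_pow_mul_rpow_neg' (k : ℕ) {c : ℝ} (hc : 0 < c) :
    Tendsto (fun D : ℕ => Real.log D ^ k * (D : ℝ) ^ (-c)) atTop (nhds 0) := by
  have h1 : Tendsto (fun y : ℝ => y ^ (k : ℝ) * Real.exp (-c * y)) atTop (nhds 0) :=
    tendsto_rpow_mul_exp_neg_mul_atTop_nhds_zero k c hc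
  have h2 : Tendsto (fun D : ℕ => Real.log (D : ℝ)) atTop atTop :=
    Real.tendsto_log_atTop.comp tendsto_natCast_atTop_atTop
  refine ((h1.comp h2).congr' ?_)
  filter_upwards [eventually_gt_atTop 0] with D hD
  have hD' : (0 : ℝ) < D := by exact_mod_cast hD
  simp only [Function.comp_apply]
  rw [Real.rpow_natCast, Real.rpow_def_of_pos hD']
  congr 1
  ring_nf

/-- Eventually `(log D)^k · D^{−c} ≤ 1`. [folklore] -/
private theorem eventually_log_pow_mul_rpow_neg_le_one (k : ℕ) {c : ℝ} (hc : 0 < c) :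
    ∃ D₁ : ℕ, ∀ D : ℕ, D₁ ≤ D → Real.log D ^ k * (D : ℝ) ^ (-c) ≤ 1 :=
  Filter.eventually_atTop.mp ((tendsto_log_pow_mul_rpow_neg' k hc).eventually (ge_mem_nhds zero_lt_one))

/-- `3 ≤ log D` once `⌈e³⌉ ≤ D`. [folklore] -/
private theorem three_le_log' {D : ℕ} (hD : ⌈Real.exp 3⌉₊ ≤ D) : 3 ≤ Real.log D := by
  have h : Real.exp 3 ≤ D := le_trans (Nat.le_ceil _) (by exact_mod_cast hD)
  exact (Real.le_log_iff_exp_le (lt_of_lt_of_le (Real.exp_pos 3) h)).mpr h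

/-- **`Z22:§15.u012` DISCHARGED** (ZHANG-L; helper under the v19 leaf `Typed.Section15A.Eq15_6` via the
edge `eq15_4_of : u008 → u009 → u012 → (15.4)`): for all large `D` and every window prime `p ∼ P`,
`‖Σ*_{ψ (mod p)} (1/2πi)∫_{(−1/2)} (Σ_m k̃(m)ψ̄(Dm)(Dm)^{s−1}) B(s,ψ)ω(s) ds‖ ≤ C·P·D^{−4/5}`.
Proof: integrate term by term in `w = 1 − s` (`integral_ktildeSeries_Bpoly_omega_eq`), isolate the
character sum `Σ*_ψ ψ(n)ψ̄(j)` (`sumPrim_integral_eq_tsum`; `≤ 1` off the diagonal below `p`, `≤ p − 1`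
always, `PrimitiveCharOrthogonality`), and bound the three regimes by
`SmoothWeight.norm_tsum_sum_term_mul_le_three`: near terms `≪ P𝓛⁵⁴/D`, diagonal `≪ Pτ₂(D)𝓛¹⁴⁴/D`,
far terms `≪ P^{5/2}𝓛¹⁸e^{−2𝓛⁸⁰¹}`; constant `C = C_b(2187 + 2C_τK + 8Z)` with `C_b = (1+|ι₂|)(|ι₃|+|ι₄|)`,
`τ₂(n) ≤ C_τn^{1/10}`, `K = majorantConst 16 8`, `Z = Σ_j τ₄(j)j^{−3/2}`.
[cite: Zhang2022LandauSiegel, §15 p. 81 (proof of (15.4))] -/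
theorem step15_u012_holds (c' : ℝ) : Step15_u012 c' := by
  obtain ⟨Cτ, -, hCτ⟩ := MeanSquareMajorant.exists_tau_le_mul_rpow 2 (show (0 : ℝ) < 1 / 10 by norm_num)
  obtain ⟨D₁, hD₁⟩ := eventually_log_pow_mul_rpow_neg_le_one 54 (show (0 : ℝ) < 1 / 5 by norm_num)
  obtain ⟨D₂, hD₂⟩ := eventually_log_pow_mul_rpow_neg_le_one 144 (show (0 : ℝ) < 1 / 10 by norm_num)
  set Cb : ℝ := (1 + ‖iota2‖) * (‖iota3‖ + ‖iota4‖) with hCb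
  set K : ℝ := MeanSquareMajorant.majorantConst 16 8 with hK
  set Z : ℝ := ∑' j : ℕ, MeanSquareMajorant.tau 4 j * (j : ℝ) ^ (-(3 / 2 : ℝ)) with hZ
  have hCb0 : 0 ≤ Cb := by positivity
  refine ⟨Cb * (2187 + 2 * Cτ * K + 8 * Z), max (max D₁ D₂) ⌈Real.exp 3⌉₊, ?_⟩
  intro D _ χ hD _ _ p hp
  have hD₁' : D₁ ≤ D := le_trans (le_trans (le_max_left _ _) (le_max_left _ _)) hD
  have hD₂' : D₂ ≤ D := le_trans (le_trans (le_max_right _ _) (le_max_left _ _)) hD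
  have hD3 : ⌈Real.exp 3⌉₊ ≤ D := le_trans (le_max_right _ _) hD
  have hℓ3 : 3 ≤ ell D := three_le_log' hD3
  have hℓ0 : 0 < ell D := by linarith
  haveI : Fact p.Prime := ⟨(Finset.mem_filter.mp hp).2⟩
  rw [sumPrim_integral_eq_tsum c' χ hℓ3 hp]
  -- hypotheses of the three-regime engine
  set Nb : ℕ := ⌈bigP D / bigT D ^ 2⌉₊ with hNb
  have hS : ∀ n ∈ Finset.Ico 1 Nb, n ≠ 0 ∧ n ≤ Nb - 1 := fun n hn => by
    obtain ⟨h1, h2⟩ := Finset.mem_Ico.mp hn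
    exact ⟨by omega, by omega⟩
  have hNp : Nb - 1 < p := Nb_pred_lt_of_mem_primeWindow hℓ3 hp
  obtain ⟨-, hu₀, -⟩ := u0_bounds hℓ3 hp
  have hp2 : 2 ≤ p := (Finset.mem_filter.mp hp).2.two_le
  have hX₂ : (0 : ℝ) ≤ (p : ℝ) - 1 := by
    have : (2 : ℝ) ≤ p := by exact_mod_cast hp2
    linarith
  have hX1 : ∀ m n : ℕ, n ∈ Finset.Ico 1 Nb → m ≠ n → m < p →
      ‖∑ ψ ∈ (Finset.univ : Finset (DirichletCharacter ℂ p)).erase 1,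
          ψ (n : ZMod p) * ψ⁻¹ (m : ZMod p)‖ ≤ 1 := by
    intro m n hn hmn hmp
    have hnp : n < p := lt_of_le_of_lt (hS n hn).2 hNp
    refine PrimChar.norm_sum_ne_one_le_one_of_ne fun h => hmn ?_
    exact ((PrimChar.natCast_eq_natCast_iff_of_lt hnp hmp).mp h).symm
  have hX2 : ∀ m n : ℕ, n ∈ Finset.Ico 1 Nb →
      ‖∑ ψ ∈ (Finset.univ : Finset (DirichletCharacter ℂ p)).erase 1,
          ψ (n : ZMod p) * ψ⁻¹ (m : ZMod p)‖ ≤ (p : ℝ) - 1 :=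
    fun m n _ => PrimChar.norm_sum_ne_one_le _ _
  obtain ⟨-, hbound⟩ := SmoothWeight.norm_tsum_sum_term_mul_le_three (ell2_pos hℓ0) (-t0 D)
    (lseriesSummable_aCoeff c' hℓ0) (fun n => bcoef D n * χ (n : ZMod D)) hS hNp hu₀
    (fun m n => ∑ ψ ∈ (Finset.univ : Finset (DirichletCharacter ℂ p)).erase 1,
      ψ (n : ZMod p) * ψ⁻¹ (m : ZMod p)) hX₂ hX1 hX2
  refine hbound.trans ?_
  -- the three regimes
  have h1 := term1_le c' χ hℓ3 hp (hD₁ D hD₁')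
  have h2 := term2_le c' χ hℓ3 hp hCτ (hD₂ D hD₂')
  have hZ'0 : 0 ≤ ∑' m : ℕ,
      ‖LSeries.term (fun j : ℕ => if D ∣ j then ktilde c' D (j / D) else 0) (3 / 2 : ℂ) m‖ :=
    tsum_nonneg fun _ => norm_nonneg _
  have h3 := term3_le χ hℓ3 hp hZ'0
  have hZ' := tsum_norm_term_aCoeff_le c' hℓ0 (D := D)
  have hP0 : 0 ≤ bigP D := (Real.exp_pos _).le
  have hDr : 0 ≤ (D : ℝ) ^ (-(4 / 5 : ℝ)) := Real.rpow_nonneg (Nat.cast_nonneg _) _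
  have h3' : Cb * (8 * ∑' m : ℕ,
      ‖LSeries.term (fun j : ℕ => if D ∣ j then ktilde c' D (j / D) else 0) (3 / 2 : ℂ) m‖) *
        bigP D * (D : ℝ) ^ (-(4 / 5 : ℝ)) ≤ Cb * (8 * Z) * bigP D * (D : ℝ) ^ (-(4 / 5 : ℝ)) := by
    gcongr
  calc _ ≤ Cb * 2187 * bigP D * (D : ℝ) ^ (-(4 / 5 : ℝ)) +
          Cb * (2 * Cτ * K) * bigP D * (D : ℝ) ^ (-(4 / 5 : ℝ)) +
          Cb * (8 * Z) * bigP D * (D : ℝ) ^ (-(4 / 5 : ℝ)) :=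
        add_le_add (add_le_add h1 h2) (h3.trans h3')
    _ = Cb * (2187 + 2 * Cτ * K + 8 * Z) * bigP D * (D : ℝ) ^ (-(4 / 5 : ℝ)) := by ring

end Final

end Literature.NumberTheory.LFunctions.Zhang2022.Typed.Section15A
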